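import Summits.QuantumFields.BalabanUV.Beta.GAN24.AffineUnroll
import Summits.QuantumFields.BalabanUV.Beta.GAN24.WSlotT2OfPieces
import Summits.QuantumFields.BalabanUV.Beta.GAN24.T2UnitSplitShapes
import Summits.QuantumFields.BalabanUV.Beta.GAN24.Push4Iter

/-!
# `BalabanUV.Beta.GAN24.T2DeviationDrift` — binder row G-an2-4 ∕ (CONV-C), CT-W, RULING R-gan24p1-g23-1 (route (R-DEV)): **«T2Drift» OF A DEVIATED TOWER — the one-step
# geometric rate of `T′_{n+1} − T′_n` from the reference tower's rate, the deviation's DIFFERENCE tower (leaf-01's `AffineUnroll.diff_eq_transport_add_sum`) and road W3's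
# END #2 `WSlotT2OfPieces.rate_of_rows` at the deviation's transport; GENERIC SOCKET ONLY (any transport family, abstract zero-mode class)**
# (row owner b2b-balaban-gan24-p1, gen 23)

NOT IN PRINT; OUR PROOF ATTEMPT.  HONEST FRAMING (cell contract, verbatim): «discharging `BetaPertH` makes Bałaban's UV stability UNCONDITIONAL — a real
constructive-QFT result; it is NOT the continuum limit and NOT the Clay problem.»  HONEST DEPENDENCY (verbatim): «continuum YM on T⁴ ⇐ BetaPertH ∧ nine spine
estimates (0/9 proved); BetaPertH ⇐ (D1) ∧ (D4) ∧ CAP+tail; G-an2-4 gates asym, D1 and NE2/3/4.»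

WHAT ([folklore] bookkeeping; 0 `def`, 0 cited facts, 0 `def … : Prop`, 0 sorry).  Companion of `T2DeviationTower` (the «T2Shape» half).  With `D := T′ − T` the deviation
of a tower `T′` from a reference tower `T`, `D_{j+1} = A_j D_j + g_j`, `D_0 = 0` (for the comb family: `T2DeviationTower.unitS₂_T2RecOf_dev_succ_of_letters`):
* §1 **`drift_of_dev_rows`** (generic additive bookkeeping on bi-tables, generic `d`; the maps `A_j` additive on bounded tables and preserving them — hypotheses):
  `T′_{n+1} − T′_n = (T_{n+1} − T_n) + (D_{n+1} − D_n)`, and the difference tower of `D` is unrolled by `AffineUnroll.diff_eq_transport_add_sum` through the SHIFTED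
  transport `𝒯^A(m+1, k)` with forcing `f_m := (A_{m+1} D_m − A_m D_m) + (g_{m+1} − g_m)` and first difference `D_1 − D_0 = g_0`; road W3's END #2 `rate_of_rows` then
  gives the geometric rate of `D_{n+1} − D_n` from: irrelevance of `𝒯^A` on `Zfree` tables (HYPOTHESIS `hTirrE`), the forcing rows `hf`∕`hZf`
  (geometric `Cf·θ^m`, `Zfree`), and `g_0`'s rows; adding the reference tower's own rate (U-drift) yields
  `∃ c ϑ δ, 0 ≤ c ∧ 0 < ϑ ∧ ϑ < 1 ∧ 0 < δ ∧ ∀ n, LocStencil₂ (T′_{n+1} − T′_n) (c·ϑ^n) δ` — the one-step «T2Drift»; the Cauchy form `∀ k j` is `WSlotT2OfPieces.cauchy_of_rate`.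
* NO COMB INSTANCE IS TYPED HERE (ruling R-gan24p1-g23-3 and the owner's numbers R4∕R6, `HOME/b2b-balaban-gan24-p1/gen23/F2-NUMERIC-v0.md`): for an2's comb tower
  the natural `A` — the DRESSED `lin4` family — amplifies the cell charge ×Lc² per step in conserved units (pure dressed composites grow like `9^k` at D = 2,
  n = 3), so no irrelevance row `hTirrE` holds for it on any class containing a four-face-charged table; the socket below is kept GENERIC (any transport `A`,
  abstract `Zfree`∕`mom`) for splittings whose transport IS controlled (road W3's undressed `𝒜^B`; the deviation's affine step for the comb tower is
  `T2DeviationTower.unitS₂_T2RecOf_dev_succ_of_letters`).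
Discharges NOTHING of «T2Shape» ∕ «T2Drift» ∕ (hW, hWall) unconditionally; NEVER «G-an2-4 closed» as (CONV-C); NOT D1, NOT `BetaPertH`, NOT continuum, NOT Clay.  2026-08-22.
-/

noncomputable section

open Finset
open scoped BigOperators
open Literature.MathematicalPhysics.QuantumFieldTheory
open Literature.MathematicalPhysics.QuantumFieldTheory.Balaban1983to89
open Literature.MathematicalPhysics.QuantumFieldTheory.Balaban1983to89.Beta
open BalabanCompositeJets (LocStencil₂ LocStencil₂.nonneg LocStencil₂.mono)
open Summit.QuantumFields.BalabanUV.Beta.GAN24.Push4Iter (BiTab)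
open Summit.QuantumFields.BalabanUV.Beta.GAN24.AffineUnroll
open Summit.QuantumFields.BalabanUV.Beta.GAN24.T2UnitSplitLevels (bdd₄_zero bdd₄_add bdd₄_sub)
open Summit.QuantumFields.BalabanUV.Beta.GAN24.T2UnitSplitShapes (bdd₄_of_locStencil₂)
open Summit.QuantumFields.BalabanUV.Beta.GAN24.WSlotT2OfPieces (rate_of_rows locStencil₂_add locStencil₂_mono)

namespace Summit.QuantumFields.BalabanUV.Beta.GAN24.T2DeviationDrift

/-! ## §1 Generic: the drift of a deviated tower -/

section Generic

variable {d : ℕ}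

/-- NOT IN PRINT; OUR BOOKKEEPING ([folklore]).  **ONE-STEP «T2Drift» OF A DEVIATED TOWER.**  Let `T T′ g : ℕ → BiTab d`, maps `A_j` additive on bounded bi-tables and
preserving boundedness, `T′_{j+1} − T_{j+1} = A_j (T′_j − T_j) + g_j`, `T′_0 = T_0`, `T`, `T′`, `g` uniformly `LocStencil₂` (boundedness only).  If the reference tower has
the one-step rate `LocStencil₂ (T_{n+1} − T_n) (cU·ϑU^n) δU` (U-drift), the forcing `f_m := (A_{m+1}(T′_m − T_m) − A_m(T′_m − T_m)) + (g_{m+1} − g_m)` is geometric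
`LocStencil₂ (f_m) (Cf·θ^m) δin` with `mom ≤ Cf·θ^m` and `Zfree`, `g_0` is `LocStencil₂ (C₀, δin)` with `mom ≤ C₀` and `Zfree`, and `𝒯^A` is IRRELEVANT on `Zfree` tables
(gain `ρ^k`, output rate `δT`), then `∃ c ϑ δ, 0 ≤ c ∧ 0 < ϑ ∧ ϑ < 1 ∧ 0 < δ ∧ ∀ n, LocStencil₂ (T′_{n+1} − T′_n) (c·ϑ^n) δ`. -/
theorem drift_of_dev_rows (T T' g : ℕ → BiTab d) (A : ℕ → BiTab d → BiTab d) (Zfree : BiTab d → Prop) (mom : BiTab d → ℝ)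
    {C₂ δ₂ C₂' δ₂' Cg δg cU ϑU δU Cf θ δin C₀ CE ρ δT : ℝ}
    (hAP : ∀ (j : ℕ) (X : BiTab d), (∃ B : ℝ, ∀ κ u κ' u' x z a b, |X κ u κ' u' x z a b| ≤ B) →
      ∃ B : ℝ, ∀ κ u κ' u' x z a b, |(A j X) κ u κ' u' x z a b| ≤ B)
    (hAadd : ∀ (j : ℕ) (X Y : BiTab d), (∃ B : ℝ, ∀ κ u κ' u' x z a b, |X κ u κ' u' x z a b| ≤ B) →
      (∃ B : ℝ, ∀ κ u κ' u' x z a b, |Y κ u κ' u' x z a b| ≤ B) → A j (X + Y) = A j X + A j Y)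
    (hrec : ∀ j, T' (j + 1) - T (j + 1) = A j (T' j - T j) + g j) (h0 : T' 0 = T 0)
    (hT : ∀ n, LocStencil₂ (T n) C₂ δ₂) (hδ₂ : 0 ≤ δ₂) (hT' : ∀ n, LocStencil₂ (T' n) C₂' δ₂') (hδ₂' : 0 ≤ δ₂')
    (hg : ∀ m, LocStencil₂ (g m) Cg δg) (hδg : 0 ≤ δg)
    (hU : ∀ n, LocStencil₂ (T (n + 1) - T n) (cU * ϑU ^ n) δU) (hcU : 0 ≤ cU) (hϑU0 : 0 ≤ ϑU) (hϑU1 : ϑU < 1) (hδU : 0 < δU)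
    (hCE : 0 ≤ CE) (hρ0 : 0 ≤ ρ) (hρ1 : ρ < 1) (hθ0 : 0 ≤ θ) (hθ1 : θ < 1)
    (hf : ∀ m, LocStencil₂ ((A (m + 1) (T' m - T m) - A m (T' m - T m)) + (g (m + 1) - g m)) (Cf * θ ^ m) δin ∧
      mom ((A (m + 1) (T' m - T m) - A m (T' m - T m)) + (g (m + 1) - g m)) ≤ Cf * θ ^ m)
    (hZf : ∀ m, Zfree ((A (m + 1) (T' m - T m) - A m (T' m - T m)) + (g (m + 1) - g m)))
    (hg0 : LocStencil₂ (g 0) C₀ δin ∧ mom (g 0) ≤ C₀) (hZg0 : Zfree (g 0))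
    (hTirrE : ∀ (m k : ℕ) (X : BiTab d) (C : ℝ), 0 ≤ C → LocStencil₂ X C δin → Zfree X → mom X ≤ C →
      LocStencil₂ (transport A m k X) (CE * C * ρ ^ k) δT) (hδT : 0 < δT) :
    ∃ c ϑ δ : ℝ, 0 ≤ c ∧ 0 < ϑ ∧ ϑ < 1 ∧ 0 < δ ∧ ∀ n, LocStencil₂ (T' (n + 1) - T' n) (c * ϑ ^ n) δ := by
  -- the class of bounded bi-tables
  have hbD : ∀ j, ∃ B : ℝ, ∀ κ u κ' u' x z a b, |(T' j - T j) κ u κ' u' x z a b| ≤ B :=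
    fun j => bdd₄_sub (bdd₄_of_locStencil₂ (hT' j) hδ₂') (bdd₄_of_locStencil₂ (hT j) hδ₂)
  have hbg : ∀ j, ∃ B : ℝ, ∀ κ u κ' u' x z a b, |g j κ u κ' u' x z a b| ≤ B := fun j => bdd₄_of_locStencil₂ (hg j) hδg
  have hD0 : T' 0 - T 0 = 0 := by rw [h0, sub_self]
  -- the difference tower of the deviation, unrolled (leaf-01's engine on the class of bounded tables)
  have hdiff := diff_eq_transport_add_sum (A := A)
    (P := fun X : BiTab d => ∃ B : ℝ, ∀ κ u κ' u' x z a b, |X κ u κ' u' x z a b| ≤ B)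
    (x := fun n => T' n - T n) (b := g) bdd₄_zero (fun _ _ => bdd₄_add) (fun _ _ => bdd₄_sub) hAP hAadd
    (by simpa using hbD 0) hbg hrec
  -- the first difference is `g 0`
  have hD1 : (T' (0 + 1) - T (0 + 1)) - (T' 0 - T 0) = g 0 := by
    rw [hrec 0, hD0, map_zero_of_add (P := fun X : BiTab d => ∃ B : ℝ, ∀ κ u κ' u' x z a b, |X κ u κ' u' x z a b| ≤ B)
      (F := A 0) bdd₄_zero (hAadd 0), zero_add, sub_zero]
  -- road W3's END #2 at the shifted transport
  obtain ⟨c, ϑ, hc, hϑ0, hϑ1, hrate⟩ := rate_of_rows (d := d) (fun n => (T' (n + 1) - T (n + 1)) - (T' n - T n))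
    (fun m => (A (m + 1) (T' m - T m) - A m (T' m - T m)) + (g (m + 1) - g m)) (fun m k => transport A (m + 1) k) Zfree mom
    hCE hρ0 hρ1 hθ0 hθ1 (fun n => hdiff n) (fun m k X C hC hX hZ hm => hTirrE (m + 1) k X C hC hX hZ hm) hf hZf
    (by show LocStencil₂ ((T' (0 + 1) - T (0 + 1)) - (T' 0 - T 0)) C₀ δin ∧ mom ((T' (0 + 1) - T (0 + 1)) - (T' 0 - T 0)) ≤ C₀
        rw [hD1]; exact hg0)
    (by show Zfree ((T' (0 + 1) - T (0 + 1)) - (T' 0 - T 0))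
        rw [hD1]; exact hZg0)
  -- add the reference tower's own rate
  set μ : ℝ := max ϑU ϑ with hμ
  have hμ0 : 0 < μ := lt_max_of_lt_right hϑ0
  have hμ1 : μ < 1 := max_lt hϑU1 hϑ1
  refine ⟨cU + c, μ, min δU δT, add_nonneg hcU hc, hμ0, hμ1, lt_min hδU hδT, fun n => ?_⟩
  have e : T' (n + 1) - T' n = (T (n + 1) - T n) + ((T' (n + 1) - T (n + 1)) - (T' n - T n)) := by abel
  rw [e]
  refine locStencil₂_mono (locStencil₂_add ((hU n).mono (min_le_left _ _)) ((hrate n).mono (min_le_right _ _))) ?_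
  have h1 : cU * ϑU ^ n ≤ cU * μ ^ n := mul_le_mul_of_nonneg_left (pow_le_pow_left₀ hϑU0 (le_max_left _ _) n) hcU
  have h2 : c * ϑ ^ n ≤ c * μ ^ n := mul_le_mul_of_nonneg_left (pow_le_pow_left₀ hϑ0.le (le_max_right _ _) n) hc
  calc cU * ϑU ^ n + c * ϑ ^ n ≤ cU * μ ^ n + c * μ ^ n := add_le_add h1 h2
    _ = (cU + c) * μ ^ n := by ring

end Generic


end Summit.QuantumFields.BalabanUV.Beta.GAN24.T2DeviationDrift

end
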